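import Literature.AlgebraicGeometry.Modules.PushforwardTrace
import Literature.AlgebraicGeometry.Modules.PushforwardIsoUnit
import Literature.AlgebraicGeometry.Modules.AffineProjectiveFrame
import Mathlib.AlgebraicGeometry.Morphisms.Affine
import HarnessLib

/-!
# Transitivity of the trace along an affine morphism with finite locally free direct images:
# `tr_{f_*F}(f_*φ) = Trace_f(tr_F(φ))`

Bourbaki, *Algebra* III §9 no. 4, Prop. 6, formula (24) (transitivity of traces: for a commutative `K`-algebra `A` with a finite
basis over `K`, an `A`-module `V` with a finite basis over `A` and an `A`-endomorphism `u` of `V`, `Tr(u_K) = Tr_{A/K}(Tr(u))`;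
held text `book:bourbakind-algebra` pp. 642–644; here for locally free sheaves, locally on the base, WITHOUT assuming bases), in sheaf form along a morphism of schemes `f : X ⟶ Y` with `f_*𝒪_X` finite locally free
(the setting of the trace `Trace_f : f_*𝒪_X → 𝒪_Y` of The Stacks Project, Tag 0BVH, `Modules/PushforwardTrace`; that file's
docstring lists transitivity as NOT done there): for `F` a finite locally free `𝒪_X`-module with `f_*F` finite locally free,

* `trace_app_pushforwardOverHom_dual_comp_smulSection` — the RANK-ONE case, any `f`: for `λ : F|_{f⁻¹V} → 𝒪|_{f⁻¹V}` and
  `s ∈ Γ(f⁻¹V, F)`, `tr_{f_*F}(f_*(λ ≫ (· s))) = Trace_f(λ(s))` — cyclicity of the trace on `Y` for the two vector bundles `f_*F`,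
  `f_*𝒪_X` (`Modules/LocallyFreeTraceCyclic`) turns `f_*λ ≫ f_*(· s)` into `f_*((· s) ≫ λ) = ` multiplication by `λ(s)` on `f_*𝒪_X`;
* `trace_app_pushforwardOverHom` — `f` AFFINE, `V ⊆ Y` affine: `tr_{f_*F}(f_*φ) = Trace_f(tr_F(φ))` for every `φ : F|_{f⁻¹V} → F|_{f⁻¹V}`
  (`f⁻¹V` is affine, so `φ = ∑_i λ_i ≫ (· φ(p_i))` by the projective coordinate system of `Modules/AffineProjectiveFrame`, and
  `tr_F(λ ≫ (· s)) = λ(s)`);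
* **`map_trace_comp_pushforwardTrace`** — `f` affine: **`f_*(tr_F) ≫ Trace_f = (f_*𝓗om(F, F) → 𝓗om(f_*F, f_*F)) ≫ tr_{f_*F}`** as
  morphisms `f_*𝓗om(F, F) ⟶ 𝒪_Y` (glue over the affine opens of `Y`).

No frame of `F` over any `f⁻¹V` is assumed (false in general). Everything is proved; no named facts. Motivation: the supertrace
transitivity (T2•) of the trace side of road №4 of the Hodge programme for an isogeny `g` (finite, hence affine); nothing here
refers to it.

## References

* N. Bourbaki, *Algebra I, Chapters 1–3* (1989), III §9 no. 4 Prop. 6 (24) (transitivity of trace, norm and characteristic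
  polynomial); II §4 no. 3 Prop. 3 (20). [BourbakiAlgebraI1989]
* The Stacks Project, Tag 0BVH (the trace of a finite locally free morphism). [StacksProject]
* R. Hartshorne, *Algebraic Geometry* (1977), II Ex. 5.1, II Prop. 5.2, IV Ex. 2.6. [Hartshorne1977]
-/

noncomputable section

-- `TopCat.Presheaf`/`Scheme.Modules` are not reducible (as in Mathlib's `AlgebraicGeometry/Modules/Sheaf.lean`).
set_option backward.isDefEq.respectTransparency false

open CategoryTheory CategoryTheory.Limits AlgebraicGeometry TopologicalSpace Opposite
open AlgebraicGeometry.Scheme.Modules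

universe u

namespace Literature.AlgebraicGeometry.Modules

open Literature.AlgebraicGeometry.Motives

variable {X Y : Scheme.{u}} (f : X ⟶ Y)

/-! ### `pushforwardOverHom` and finite sums -/

/-- `pushforwardOverHom` of a finite sum. [cite: Hartshorne1977, II §5 pp. 109–110 (sheaf Hom and direct images)] -/
theorem pushforwardOverHom_sum {E M : X.Modules} {U : Y.Opens} {ι : Type*} (t : Finset ι)
    (φ : ι → (E.over (f ⁻¹ᵁ U) ⟶ M.over (f ⁻¹ᵁ U))) :
    pushforwardOverHom f E M (∑ i ∈ t, φ i) = ∑ i ∈ t, pushforwardOverHom f E M (φ i) :=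
  map_sum (AddMonoidHom.mk' (pushforwardOverHom f E M) pushforwardOverHom_add) φ t

/-! ### The rank-one case (any `f`) -/

section RankOne

variable {F : X.Modules} (h : IsFiniteLocallyFree ((pushforward f).obj (unitModule X)))
  (hfF : IsFiniteLocallyFree ((pushforward f).obj F))

/-- **Transitivity of the trace on a rank-one endomorphism**: for `λ : F|_{f⁻¹V} → 𝒪|_{f⁻¹V}` and `s ∈ Γ(f⁻¹V, F)`,
`tr_{f_*F}(f_*(λ ≫ (· s))) = Trace_f(λ(s))` in `Γ(Y, V)` — by cyclicity `tr_{f_*F}(f_*λ ≫ f_*(· s)) = tr_{f_*𝒪}(f_*((· s) ≫ λ))`,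
and `(· s) ≫ λ` is multiplication by `λ(s)`, whose `f_*` is `pushforwardMul f` at `λ(s)`. [cite: BourbakiAlgebraI1989, III §9 no. 4 Prop. 6 (24)]
[cite: StacksProject, Tag 0BVH] -/
theorem trace_app_pushforwardOverHom_dual_comp_smulSection {V : Y.Opens} (s : Γ(F, f ⁻¹ᵁ V))
    (lam : F.over (f ⁻¹ᵁ V) ⟶ (unitModule X).over (f ⁻¹ᵁ V)) :
    (trace hfF).app V (pushforwardOverHom f F F (lam ≫ smulSection s)) =
      (pushforwardTrace f h).app V (appLE lam (𝟙 (f ⁻¹ᵁ V)) s : Γ(unitModule X, f ⁻¹ᵁ V)) := by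
  rw [pushforwardOverHom_comp', trace_app_comp_comm hfF h, ← pushforwardOverHom_comp', smulSection_comp_eq_overScalar,
    ← pushforwardMul_app_apply, pushforwardTrace_app_apply]

end RankOne

/-! ### The affine case and the global statement -/

section Affine

variable [IsAffineHom f] {F : X.Modules} (hF : IsFiniteLocallyFree F)
  (h : IsFiniteLocallyFree ((pushforward f).obj (unitModule X))) (hfF : IsFiniteLocallyFree ((pushforward f).obj F))

/-- **Transitivity of the trace over an affine open** (`f` affine, `V ⊆ Y` affine): for every endomorphism `φ` of `F|_{f⁻¹V}`,
`tr_{f_*F}(f_*φ) = Trace_f(tr_F(φ))` in `Γ(Y, V)` — `f⁻¹V` is affine, so `φ = ∑_i λ_i ≫ (· φ(p_i))` for a projective coordinate system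
`(p_i, λ_i)` of `F|_{f⁻¹V}`, and both sides are additive with the same value `Trace_f(λ_i(φ(p_i)))` on the rank-one terms.
[cite: BourbakiAlgebraI1989, III §9 no. 4 Prop. 6 (24)] [cite: StacksProject, Tag 0BVH] -/
theorem trace_app_pushforwardOverHom {V : Y.Opens} (hV : IsAffineOpen V) (φ : F.over (f ⁻¹ᵁ V) ⟶ F.over (f ⁻¹ᵁ V)) :
    (trace hfF).app V (pushforwardOverHom f F F φ) = (pushforwardTrace f h).app V ((trace hF).app (f ⁻¹ᵁ V) φ) := by
  obtain ⟨n, p, lam, hid⟩ := exists_sum_dual_comp_smulSection_eq_id hF (hV.preimage f)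
  rw [eq_sum_dual_comp_smulSection hid φ, pushforwardOverHom_sum]
  simp only [map_sum]
  exact Finset.sum_congr rfl fun i _ => by
    rw [trace_app_pushforwardOverHom_dual_comp_smulSection, trace_app_dual_comp_smulSection]

/-- **Transitivity of the trace along an affine morphism with finite locally free direct images**:
`f_*(tr_F) ≫ Trace_f = (f_*𝓗om(F, F) → 𝓗om(f_*F, f_*F)) ≫ tr_{f_*F}` as morphisms `f_*𝓗om(F, F) ⟶ 𝒪_Y`, for `F` and `f_*F` finite
locally free and `f_*𝒪_X` finite locally free (e.g. `f` finite locally free; an isogeny of abelian varieties). Two sections of `𝒪_Y`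
agreeing on the affine opens are equal; on an affine `V` this is `trace_app_pushforwardOverHom`.
[cite: BourbakiAlgebraI1989, III §9 no. 4 Prop. 6 (24)] [cite: StacksProject, Tag 0BVH] [cite: Hartshorne1977, IV Ex. 2.6] -/
theorem map_trace_comp_pushforwardTrace :
    (pushforward f).map (trace hF) ≫ pushforwardTrace f h = sheafHomPushforwardComparison f F F ≫ trace hfF := by
  apply Scheme.Modules.hom_ext
  intro V
  ext φ
  change (pushforwardTrace f h).app V ((trace hF).app (f ⁻¹ᵁ V) φ) = (trace hfF).app V (pushforwardOverHom f F F φ)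
  -- both sides are sections of `𝒪_Y` over `V`; compare them on the affine opens `W ≤ V`
  refine TopCat.Sheaf.eq_of_locally_eq' (Y.sheaf : TopCat.Sheaf CommRingCat Y)
    (fun W : {W : Y.affineOpens // (W : Y.Opens) ≤ V} => (W.1 : Y.Opens)) V (fun W => homOfLE W.2) ?_ _ _ fun W => ?_
  · intro y hy
    obtain ⟨_, ⟨W, hW, rfl⟩, hyW, hWV⟩ := Y.isBasis_affineOpens.exists_subset_of_mem_open hy V.2
    exact Opens.mem_iSup.2 ⟨⟨⟨W, hW⟩, hWV⟩, hyW⟩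
  · obtain ⟨⟨W, hW⟩, hWV⟩ := W
    change Y.presheaf.map (homOfLE hWV).op ((pushforwardTrace f h).app V ((trace hF).app (f ⁻¹ᵁ V) φ)) =
      Y.presheaf.map (homOfLE hWV).op ((trace hfF).app V (pushforwardOverHom f F F φ))
    rw [map_trace_app hfF, restrictHom_pushforwardOverHom, trace_app_pushforwardOverHom f hF h hfF hW, ← map_trace_app hF]
    exact (Scheme.Modules.Hom.app_map_apply (pushforwardTrace f h) (homOfLE hWV) _).symm

end Affine

end Literature.AlgebraicGeometry.Modules

end
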